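import Mathlib.MeasureTheory.Integral.DominatedConvergence
import Mathlib.Probability.Martingale.Basic
import Literature.Probability.RandomPlanarGeometry.SLETwoPointFlowProofs
import Literature.Probability.RandomPlanarGeometry.SwallowingProbCalculus
import Literature.Probability.RandomPlanarGeometry.LocalMartingaleProofs
import Literature.Probability.RandomPlanarGeometry.SLEBoundaryHittingProofs
import HarnessLib

/-!
# Lawler's Prop. 6.33 from the two-point martingale: optional stopping and the assembly

Topic `Probability/RandomPlanarGeometry`; theorems only. We prove **Lawler (2005), Prop. 6.33**
(with the sentence preceding it) — the named fact `Literature.Probability.RandomPlanarGeometry.sle_measureReal_swallowingTime_lt` of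
`SLEBoundaryHitting`: for chordal SLE_κ, `κ > 4`, and `x, y > 0`,
`P{T_x < T_{-y}} = P{T_{-x} < T_y} = Ψ_{2/κ}(y/(x+y))` — from

* the Itô step `Literature.Probability.RandomPlanarGeometry.sle_martingale_twoPointObservable` (`SLETwoPointMartingale`: Lawler's
  `ψ(Z_{t∧σ})` is a martingale), and
* a.s. swallowing of positive reals for `κ > 4`, `Literature.Analysis.FunctionSpaces.sle_swallows_real_iff` (`ItoProcesses`;
  Rohde–Schramm (2005), Lemma 6.5 / Lawler (2005), Prop. 6.8),

following the printed proof (proof of Prop. 1.21, first paragraph: "`M_t` is a bounded martingale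
and hence by the optional sampling theorem `P{X_σ = x₂} = E[M_∞ | 𝓕₀] = φ₀(x)`"):

1. `E[M_t] = E[M_0] = Ψₐ(x/(x-y))` for all `t` (martingale property on `Set.univ`;
   `sleTwoPointObservable_zero`), `a = 2/κ ∈ (0, 1/2)`;
2. `0 ≤ M ≤ 1` (`Zₜ ∈ (0,1)` before `σ`, `SLETwoPointFlowProofs`; `Ψₐ([0,1)) ⊆ [0,1]`,
   `SwallowingProbCalculus`);
3. a.s. `T_x < ∞` (`sle_swallows_real_iff`), so a.s. `σ < ∞` and `M_n = 𝟙{T_y < T_x}` for all large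
   `n : ℕ` (the regularised observable is eventually *equal* to the crossing indicator);
4. dominated convergence along `n → ∞`: `P{T_y < T_x} = Ψₐ(x/(x-y))`
   (`measureReal_swallowingTime_lt_swallowingTime`; the event is shown to be null-measurable
   by comparison with the measurable event `{M_n = 1 eventually}`);
5. a.s. `T_x ≠ T_y` (`SLETwoPointFlowProofs.sle_swallowingTime_ne`), so
   `P{T_x < T_y} = 1 - Ψₐ(x/(x-y)) = Ψₐ(-y/(x-y))` by the symmetry `Ψₐ(1-r) = 1 - Ψₐ(r)`
   (`swallowingProb_one_sub`; Lawler: "symmetry about the imaginary axis");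
6. the two conjuncts of `sle_measureReal_swallowingTime_lt` are the cases `(x, -y)` and
   `(y, -x)` of 5 and 4 (`sle_measureReal_swallowingTime_lt_of_martingale`).

Consequently **Cardy's formula for SLE₆ in a conformal rectangle**
(`CritPerc.sle_six_measureReal_hitsBefore` of `CritPercSLE`) follows from the two stochastic
facts `sle_martingale_twoPointObservable` and `sle_swallows_real_iff` alone
(`CritPerc.sle_six_measureReal_hitsBefore_of_martingale`, through
`CritPerc.sle_six_measureReal_hitsBefore_of_stochasticFacts` of `SLEBoundaryHittingProofs`).

## Mathlib

`MeasureTheory.Martingale.setIntegral_eq`, `tendsto_integral_of_dominated_convergence`,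
`integral_indicator_one`, `measureReal_congr`, `NullMeasurableSet.congr`,
`probReal_compl_eq_one_sub`; the probability-measure instance is
`Literature.Probability.RandomPlanarGeometry.isProbabilityMeasure_preWienerMeasure'` (`LocalMartingaleProofs`, from the proved Kolmogorov
extension theorem).

## References

* G. F. Lawler, *Conformally Invariant Processes in the Plane*, AMS (2005): §6.7, Prop. 6.33 and
  the sentence preceding it; §1.10, proof of Prop. 1.21 (first paragraph).
* S. Rohde, O. Schramm, *Basic properties of SLE*, Ann. of Math. 161 (2005), Lemma 6.5.
-/

noncomputable section

open Set Filter Topology MeasureTheory Complex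
open scoped NNReal ENNReal

namespace Literature.Probability.RandomPlanarGeometry

open Loewner

section TwoPoint

variable {κ : ℝ≥0} {x y : ℝ}

/-- For `κ > 4`, Lawler's exponent `a = 2/κ` lies in `(0, 1/2)`. [cite: Lawler2005, Prop. 6.33] -/
theorem two_div_mem_Ioo (hκ : 4 < κ) : 2 / (κ : ℝ) ∈ Ioo (0 : ℝ) (1 / 2) := by
  have hκ' : (4 : ℝ) < κ := by exact_mod_cast hκ
  have hκ0 : (0 : ℝ) < κ := by linarith
  refine ⟨div_pos two_pos hκ0, ?_⟩
  rw [div_lt_iff₀ hκ0]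
  linarith

/-- **The two-point observable takes values in `[0, 1]`** (`κ > 4`, `y < 0 < x`), for every sample
path and time: before `σ` it is `Ψ_{2/κ}(Zₜ)` with `Zₜ ∈ (0, 1)`, afterwards `0` or `1`. (Lawler:
"`M_t` is a bounded martingale".) [cite: Lawler2005, Prop. 6.33] -/
theorem sleTwoPointObservable_mem_Icc (hκ : 4 < κ) (hx : 0 < x) (hy : y < 0) (t : ℝ≥0)
    (ω : ℝ≥0 → ℝ) : sleTwoPointObservable κ x y t ω ∈ Icc (0 : ℝ) 1 := by
  by_cases ht : (t : WithTop ℝ≥0) < twoPointTime (sleDriving κ ω) x y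
  · rw [sleTwoPointObservable_of_lt ht]
    have hZ := sle_twoPointRatio_mem_Ioo hx hy ht
    have ha := two_div_mem_Ioo hκ
    exact swallowingProb_mem_Icc ha.1 ha.2 ⟨hZ.1.le, hZ.2⟩
  · rw [sleTwoPointObservable_of_le (not_lt.1 ht)]
    split_ifs <;> simp

/-- **The observable is eventually the crossing indicator**: if `T_x(ω) < ∞` then for all large
`n : ℕ`, `M_n(ω) = 𝟙{T_y < T_x}(ω)`. [cite: Lawler2005, Prop. 6.33] -/
theorem sleTwoPointObservable_eventually_eq {ω : ℝ≥0 → ℝ}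
    (hT : swallowingTime (sleDriving κ ω) x < ⊤) :
    ∀ᶠ n : ℕ in atTop, sleTwoPointObservable κ x y n ω =
      if swallowingTime (sleDriving κ ω) y < swallowingTime (sleDriving κ ω) x then 1 else 0 := by
  have hσ : twoPointTime (sleDriving κ ω) x y ≠ ⊤ := ((twoPointTime_le_left x y).trans_lt hT).ne
  obtain ⟨s, hs⟩ := WithTop.ne_top_iff_exists.1 hσ
  obtain ⟨N, hN⟩ := exists_nat_ge (s : ℝ)
  refine eventually_atTop.2 ⟨N, fun n hn ↦ sleTwoPointObservable_of_le ?_⟩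
  rw [← hs, WithTop.coe_le_coe, ← NNReal.coe_le_coe]
  push_cast
  exact hN.trans (by exact_mod_cast hn)

/-- **`P{T_y < T_x} = Ψ_{2/κ}(x/(x-y))`** for chordal SLE_κ, `κ > 4`, `y < 0 < x` (Lawler (2005),
Prop. 6.33 in the form `P{Z_σ = 1} = ψ(Z₀)`, `Z₀ = x/(x-y)`), from the two-point martingale (`hS`)
and a.s. finiteness of `T_x` (`hfin`): `E[M_n] = Ψ(Z₀)` for all `n`, `M_n → 𝟙{T_y < T_x}` a.s. (eventually
equal), `0 ≤ M ≤ 1`, dominated convergence. Also: the event is null-measurable (it agrees a.e.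
with the measurable event "`M_n = 1` eventually"). [cite: Lawler2005, Prop. 6.33] -/
theorem measureReal_swallowingTime_lt_swallowingTime (hS : sle_martingale_twoPointObservable)
    (hfin : ∀ᵐ ω ∂Process.preWienerMeasure, swallowingTime (sleDriving κ ω) x < ⊤)
    (hκ : 4 < κ) (hx : 0 < x) (hy : y < 0) :
    Process.preWienerMeasure.real {ω | swallowingTime (sleDriving κ ω) y <
        swallowingTime (sleDriving κ ω) x} = swallowingProb (2 / (κ : ℝ)) (x / (x - y)) ∧
      NullMeasurableSet {ω | swallowingTime (sleDriving κ ω) y <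
        swallowingTime (sleDriving κ ω) x} Process.preWienerMeasure := by
  haveI := isProbabilityMeasure_preWienerMeasure'
  set M : ℝ≥0 → (ℝ≥0 → ℝ) → ℝ := sleTwoPointObservable κ x y with hMdef
  have hM : Martingale M brownianFiltration Process.preWienerMeasure := hS hκ hx hy
  set c : ℝ := swallowingProb (2 / (κ : ℝ)) (x / (x - y)) with hcdef
  set A : Set (ℝ≥0 → ℝ) := {ω | swallowingTime (sleDriving κ ω) y <
    swallowingTime (sleDriving κ ω) x} with hAdef
  have hmeas : ∀ t, Measurable (M t) := fun t ↦
    ((hM.stronglyMeasurable t).mono (brownianFiltration.le t)).measurable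
  -- 1. the expectation is constant, `= Ψ(Z₀)`
  have h0 : ∀ ω, M 0 ω = c := fun ω ↦ sleTwoPointObservable_zero hx hy ω
  have hint : ∀ t : ℝ≥0, ∫ ω, M t ω ∂Process.preWienerMeasure = c := by
    intro t
    have h1 := hM.setIntegral_eq (zero_le : (0 : ℝ≥0) ≤ t) (s := univ) MeasurableSet.univ
    rw [setIntegral_univ, setIntegral_univ] at h1
    rw [← h1, integral_congr_ae (ae_of_all _ h0), integral_const, smul_eq_mul,
      probReal_univ, one_mul]
  -- 2. the measurable proxy of `A`
  set A' : Set (ℝ≥0 → ℝ) := ⋃ N : ℕ, ⋂ n : ℕ, {ω | N ≤ n → M n ω = 1} with hA'def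
  have hA' : MeasurableSet A' := by
    refine MeasurableSet.iUnion fun N ↦ MeasurableSet.iInter fun n ↦ ?_
    by_cases hNn : N ≤ n
    · have : {ω : ℝ≥0 → ℝ | N ≤ n → M n ω = 1} = M n ⁻¹' {1} := by
        ext ω; simp [hNn]
      rw [this]
      exact hmeas n (measurableSet_singleton 1)
    · have : {ω : ℝ≥0 → ℝ | N ≤ n → M n ω = 1} = univ := by
        ext ω; simp [hNn]
      rw [this]
      exact MeasurableSet.univ
  have hmemA' : ∀ ω, ω ∈ A' ↔ ∀ᶠ n : ℕ in atTop, M n ω = 1 := by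
    intro ω
    simp only [hA'def, mem_iUnion, mem_iInter, mem_setOf_eq, eventually_atTop]
  -- on `{T_x < ∞}`: `M_n` is eventually the indicator, and `A = A'`
  have hAA' : ∀ ω, swallowingTime (sleDriving κ ω) x < ⊤ → (ω ∈ A ↔ ω ∈ A') := by
    intro ω hω
    have hev := sleTwoPointObservable_eventually_eq (κ := κ) (x := x) (y := y) hω
    rw [hmemA']
    constructor
    · intro hA
      filter_upwards [hev] with n hn
      rw [hMdef, hn, if_pos (show swallowingTime (sleDriving κ ω) y < swallowingTime (sleDriving κ ω) x
        from hA)]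
    · intro h1
      by_contra hA
      obtain ⟨n, hn⟩ := (h1.and hev).exists
      rw [hMdef, if_neg (show ¬ swallowingTime (sleDriving κ ω) y < swallowingTime (sleDriving κ ω) x
        from hA)] at hn
      exact one_ne_zero (hn.1.symm.trans hn.2)
  have hAA'ae : A =ᵐ[Process.preWienerMeasure] A' := by
    rw [Filter.eventuallyEq_set]
    filter_upwards [hfin] with ω hω using hAA' ω hω
  have hAnull : NullMeasurableSet A Process.preWienerMeasure := hA'.nullMeasurableSet.congr hAA'ae.symm
  refine ⟨?_, hAnull⟩
  -- 3./4. dominated convergence along `n : ℕ`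
  have hlim : ∀ᵐ ω ∂Process.preWienerMeasure,
      Tendsto (fun n : ℕ ↦ M n ω) atTop (𝓝 (A'.indicator 1 ω)) := by
    filter_upwards [hfin] with ω hω
    have hev := sleTwoPointObservable_eventually_eq (κ := κ) (x := x) (y := y) hω
    refine (tendsto_const_nhds (x := A'.indicator (1 : (ℝ≥0 → ℝ) → ℝ) ω)).congr' ?_
    filter_upwards [hev] with n hn
    rw [hMdef, hn]
    by_cases hA : ω ∈ A
    · rw [if_pos (show swallowingTime (sleDriving κ ω) y < swallowingTime (sleDriving κ ω) x from hA),
        indicator_of_mem ((hAA' ω hω).1 hA), Pi.one_apply]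
    · rw [if_neg (show ¬ swallowingTime (sleDriving κ ω) y < swallowingTime (sleDriving κ ω) x from hA),
        indicator_of_notMem (fun h ↦ hA ((hAA' ω hω).2 h))]
  have hbound : ∀ n : ℕ, ∀ᵐ ω ∂Process.preWienerMeasure, ‖M n ω‖ ≤ (1 : ℝ) := fun n ↦
    ae_of_all _ fun ω ↦ by
      have h := sleTwoPointObservable_mem_Icc hκ hx hy (n : ℝ≥0) ω
      rw [Real.norm_eq_abs, abs_le]
      exact ⟨by linarith [h.1], h.2⟩
  have hdct := tendsto_integral_of_dominated_convergence (fun _ ↦ (1 : ℝ))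
    (fun n ↦ (hmeas n).aestronglyMeasurable) (integrable_const 1) hbound hlim
  have hconst : Tendsto (fun n : ℕ ↦ ∫ ω, M n ω ∂Process.preWienerMeasure) atTop (𝓝 c) := by
    simp only [hint]
    exact tendsto_const_nhds
  have hcA' : ∫ ω, A'.indicator 1 ω ∂Process.preWienerMeasure = c := tendsto_nhds_unique hdct hconst
  rw [integral_indicator_one hA'] at hcA'
  rw [measureReal_congr hAA'ae, hcA']

/-- **`P{T_x < T_y} = Ψ_{2/κ}(-y/(x-y))`** for chordal SLE_κ, `κ > 4`, `y < 0 < x` (Lawler (2005),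
Prop. 6.33: `P{T_{-y} > T_1} = ψ(y/(y+1))`): the complement of
`measureReal_swallowingTime_lt_swallowingTime` (a.s. `T_x ≠ T_y`) and the symmetry
`Ψₐ(1-r) = 1 - Ψₐ(r)`. [cite: Lawler2005, Prop. 6.33] -/
theorem measureReal_swallowingTime_lt_swallowingTime' (hS : sle_martingale_twoPointObservable)
    (hfin : ∀ᵐ ω ∂Process.preWienerMeasure, swallowingTime (sleDriving κ ω) x < ⊤)
    (hκ : 4 < κ) (hx : 0 < x) (hy : y < 0) :
    Process.preWienerMeasure.real {ω | swallowingTime (sleDriving κ ω) x <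
        swallowingTime (sleDriving κ ω) y} = swallowingProb (2 / (κ : ℝ)) (-y / (x - y)) := by
  haveI := isProbabilityMeasure_preWienerMeasure'
  obtain ⟨hA, hAnull⟩ := measureReal_swallowingTime_lt_swallowingTime hS hfin hκ hx hy
  -- `{T_x < T_y} = {T_y < T_x}ᶜ` a.e.
  have hBA : {ω | swallowingTime (sleDriving κ ω) x < swallowingTime (sleDriving κ ω) y}
      =ᵐ[Process.preWienerMeasure]
      ({ω | swallowingTime (sleDriving κ ω) y < swallowingTime (sleDriving κ ω) x}ᶜ : Set _) := by
    rw [Filter.eventuallyEq_set]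
    filter_upwards [hfin] with ω hω
    have hne := sle_swallowingTime_ne (κ := κ) (y := y) hx hy hω
    simp only [mem_setOf_eq, mem_compl_iff, not_lt]
    exact ⟨le_of_lt, fun h ↦ lt_of_le_of_ne h hne⟩
  rw [measureReal_congr hBA, probReal_compl_eq_one_sub₀ hAnull, hA]
  have ha := two_div_mem_Ioo hκ
  have hxy : 0 < x - y := by linarith
  have hr : x / (x - y) ∈ Ioo (0 : ℝ) 1 :=
    ⟨div_pos hx hxy, (div_lt_one hxy).2 (by linarith)⟩
  rw [← swallowingProb_one_sub ha.1 ha.2 hr]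
  congr 1
  field_simp
  ring

/-- **Lawler (2005), Prop. 6.33 (with the sentence preceding it), from the two-point martingale
and a.s. finiteness of the swallowing times**: the named fact `Literature.Probability.RandomPlanarGeometry.sle_measureReal_swallowingTime_lt`
(`SLEBoundaryHitting`) follows from the Itô step `sle_martingale_twoPointObservable`
(`SLETwoPointMartingale`) and the a.s. finiteness of `T_x` for `κ > 4`, `x > 0` (per point). The two
conjuncts are the configurations `(x, -y)` and `(y, -x)` of
`measureReal_swallowingTime_lt_swallowingTime'`, resp. `measureReal_swallowingTime_lt_swallowingTime`.
[cite: Lawler2005, Prop. 6.33] -/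
theorem sle_measureReal_swallowingTime_lt_of_martingale_of_ae (hS : sle_martingale_twoPointObservable)
    (hfin : ∀ ⦃κ : ℝ≥0⦄, 4 < κ → ∀ ⦃x : ℝ⦄, 0 < x →
      ∀ᵐ ω ∂Process.preWienerMeasure, swallowingTime (sleDriving κ ω) x < ⊤) :
    sle_measureReal_swallowingTime_lt := by
  intro κ hκ x y hx hy
  constructor
  · have h := measureReal_swallowingTime_lt_swallowingTime' hS (hfin hκ hx) hκ hx (neg_lt_zero.2 hy)
    rw [h]
    congr 1
    rw [neg_neg, sub_neg_eq_add]
  · have h := (measureReal_swallowingTime_lt_swallowingTime hS (hfin hκ hy) hκ hy (neg_lt_zero.2 hx)).1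
    rw [h]
    congr 1
    rw [sub_neg_eq_add, add_comm]

/-- **Lawler (2005), Prop. 6.33, from the two-point martingale and a.s. swallowing**: discharge of
the named fact `Literature.Probability.RandomPlanarGeometry.sle_measureReal_swallowingTime_lt` modulo the stochastic facts
`sle_martingale_twoPointObservable` (the Itô step) and `sle_swallows_real_iff` (`ItoProcesses`,
Rohde–Schramm Lemma 6.5, used only in the direction "`κ > 4 ⇒` a.s. `T_x < ∞`").
[cite: Lawler2005, Prop. 6.33] -/
theorem sle_measureReal_swallowingTime_lt_of_martingale (hS : sle_martingale_twoPointObservable)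
    (h₃ : Literature.Analysis.FunctionSpaces.sle_swallows_real_iff) : sle_measureReal_swallowingTime_lt :=
  sle_measureReal_swallowingTime_lt_of_martingale_of_ae hS fun _ hκ _ hx ↦
    (h₃ (lt_trans (by norm_num) hκ) hx).2 hκ

/-- **Cardy's formula for SLE₆ from the two-point martingale and a.s. finiteness of the swallowing
times** (per point, `κ > 4`): through `CritPerc.sle_six_measureReal_hitsBefore_of_ae` of
`CritPercSLEProofs`, with swallowing = hitting of rays (`sle_swallowingTime_ofReal_eq_firstHit_holds`)
and Carathéodory's theorem from the Jordan curve theorem (both proved in `Literature`).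
[cite: Lawler2005, Prop. 6.33] -/
theorem sle_six_measureReal_hitsBefore_of_martingale_of_ae
    (hS : sle_martingale_twoPointObservable)
    (hfin : ∀ ⦃κ : ℝ≥0⦄, 4 < κ → ∀ ⦃x : ℝ⦄, 0 < x →
      ∀ᵐ ω ∂Process.preWienerMeasure, swallowingTime (sleDriving κ ω) x < ⊤) :
    RandomPlanarGeometry.sle_six_measureReal_hitsBefore :=
  RandomPlanarGeometry.sle_six_measureReal_hitsBefore_of_ae (sle_measureReal_swallowingTime_lt_of_martingale_of_ae hS hfin)
    sle_swallowingTime_ofReal_eq_firstHit_holds (fun _ hx ↦ hfin (by norm_num) hx)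
    (JordanDomain.exists_continuousOn_extension_of_jordanCurveTheorem Literature.Topology.PlaneTopology.JordanCurveTheorem_holds)

/-- **Cardy's formula for SLE₆ in a conformal rectangle from the two-point martingale**: the
target statement `CritPerc.sle_six_measureReal_hitsBefore` (`CritPercSLE`; Werner (2007), §3
p. 19; Lawler (2005), Prop. 6.33 at `κ = 6`) follows from the two remaining stochastic-calculus
facts, Lawler's two-point martingale `sle_martingale_twoPointObservable` and a.s. swallowing
`sle_swallows_real_iff`; everything else (the deterministic Loewner theory, the boundary
correspondence, the Jordan curve theorem, the special functions, and the optional-stopping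
argument of this file) is proved in `Literature`. [cite: Lawler2005, Prop. 6.33] -/
theorem sle_six_measureReal_hitsBefore_of_martingale
    (hS : sle_martingale_twoPointObservable) (h₃ : Literature.Analysis.FunctionSpaces.sle_swallows_real_iff) :
    RandomPlanarGeometry.sle_six_measureReal_hitsBefore :=
  RandomPlanarGeometry.sle_six_measureReal_hitsBefore_of_stochasticFacts
    (sle_measureReal_swallowingTime_lt_of_martingale hS h₃) h₃

end TwoPoint


/-! ### The paths of the two-point observable are continuous

Supporting evidence for the regularisation convention of `Literature.Probability.RandomPlanarGeometry.sleTwoPointObservable` (the value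
frozen from `σ` on is the left limit `Ψ(Z_{σ-})`): every path `t ↦ M_t(ω)` is continuous on
`ℝ≥0`. Not used in the proof of Prop. 6.33 above. -/

section Paths

variable {κ : ℝ≥0} {x y : ℝ}

/-- The set of times `{s : ℝ≥0 | ↑s < T}` before a `WithTop ℝ≥0`-valued time is open. [folklore] -/
theorem isOpen_setOf_coe_lt (T : WithTop ℝ≥0) : IsOpen {s : ℝ≥0 | (s : WithTop ℝ≥0) < T} := by
  induction T using WithTop.recTopCoe with
  | top =>
    have : {s : ℝ≥0 | (s : WithTop ℝ≥0) < ⊤} = univ := eq_univ_of_forall fun s ↦ WithTop.coe_lt_top s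
    rw [this]
    exact isOpen_univ
  | coe b =>
    simp only [WithTop.coe_lt_coe]
    exact isOpen_Iio

/-- The real flow `s ↦ X_s = re g_s(x) - W_s` is continuous on `{s | s < T_x}` (continuous driving
function). [folklore] -/
theorem Loewner.continuousOn_realFlow {W : ℝ≥0 → ℝ} (hW : Continuous W) {x : ℝ} (hx : (x : ℂ) ≠ W 0) :
    ContinuousOn (fun s : ℝ≥0 ↦ Loewner.realFlow W x s)
      {s | (s : WithTop ℝ≥0) < Loewner.swallowingTime W x} := by
  obtain ⟨g, hg⟩ := Loewner.exists_isSolution_swallowingTime_holds hW hx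
  have hmaps : MapsTo (fun s : ℝ≥0 ↦ (s : ℝ)) {s | (s : WithTop ℝ≥0) < Loewner.swallowingTime W x}
      {t : ℝ | 0 ≤ t ∧ (t.toNNReal : WithTop ℝ≥0) < Loewner.swallowingTime W x} :=
    fun s hs ↦ ⟨s.coe_nonneg, by simpa using hs⟩
  have h1 : ContinuousOn (fun s : ℝ≥0 ↦ (g s).re - W s)
      {s | (s : WithTop ℝ≥0) < Loewner.swallowingTime W x} :=
    (continuous_re.comp_continuousOn
      (hg.continuousOn.comp NNReal.continuous_coe.continuousOn hmaps)).sub hW.continuousOn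
  exact h1.congr fun s hs ↦ Loewner.realFlow_eq_re_sub hW hg hs

/-- Lawler's ratio `s ↦ Z_s` is continuous on `{s | s < σ}` (continuous driving function,
`y < W₀ < x`). [folklore] -/
theorem Loewner.continuousOn_twoPointRatio {W : ℝ≥0 → ℝ} (hW : Continuous W) {x y : ℝ}
    (hx : W 0 < x) (hy : y < W 0) :
    ContinuousOn (fun s : ℝ≥0 ↦ Loewner.twoPointRatio W x y s)
      {s | (s : WithTop ℝ≥0) < Loewner.twoPointTime W x y} := by
  have hx' : (x : ℂ) ≠ W 0 := fun h ↦ hx.ne' (by exact_mod_cast h)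
  have hy' : (y : ℂ) ≠ W 0 := fun h ↦ hy.ne (by exact_mod_cast h)
  have hX := (Loewner.continuousOn_realFlow hW hx').mono
    (fun s (hs : (s : WithTop ℝ≥0) < Loewner.twoPointTime W x y) ↦
      (Loewner.coe_lt_twoPointTime_iff.1 hs).1)
  have hY := (Loewner.continuousOn_realFlow hW hy').mono
    (fun s (hs : (s : WithTop ℝ≥0) < Loewner.twoPointTime W x y) ↦
      (Loewner.coe_lt_twoPointTime_iff.1 hs).2)
  refine (hX.div (hX.sub hY) fun s hs ↦ ?_)
  have h1 := Loewner.realFlow_pos hW hx (Loewner.coe_lt_twoPointTime_iff.1 hs).1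
  have h2 := Loewner.realFlow_neg hW hy (Loewner.coe_lt_twoPointTime_iff.1 hs).2
  exact (by linarith : realFlow W x s - realFlow W y s ≠ 0)

/-- **The paths of the two-point observable are continuous** (`κ > 4`, `y < 0 < x`, every sample
path): on `[0, σ)` it is `Ψ_{2/κ} ∘ Z` (continuous), on `[σ, ∞)` it is constant, and at `σ` the
left limit of `Ψ(Z_s)` is the frozen value (`Z_s → 1`, `Ψ(1-) = 1` if `T_y < T_x`; `Z_s → 0`,
`Ψ(0) = 0` if `T_x < T_y`; `T_x ≠ T_y`). This justifies the regularisation in the definition of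
`Literature.Probability.RandomPlanarGeometry.sleTwoPointObservable` (Lawler's `ψ(Z_{t∧σ})` is a *continuous* bounded martingale).
[cite: Lawler2005, Prop. 6.33] -/
theorem continuous_sleTwoPointObservable (hκ : 4 < κ) (hx : 0 < x) (hy : y < 0) (ω : ℝ≥0 → ℝ) :
    Continuous fun t : ℝ≥0 ↦ sleTwoPointObservable κ x y t ω := by
  have hW : Continuous (sleDriving κ ω) := continuous_sleDriving κ ω
  have hW0x : sleDriving κ ω 0 < x := by rwa [sleDriving_zero]
  have hW0y : y < sleDriving κ ω 0 := by rwa [sleDriving_zero]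
  have ha := two_div_mem_Ioo hκ
  set σ := twoPointTime (sleDriving κ ω) x y with hσdef
  -- on `{s < σ}` the observable is `Ψ ∘ Z`, continuous
  have hMU : ContinuousOn (fun s : ℝ≥0 ↦ sleTwoPointObservable κ x y s ω)
      {s | (s : WithTop ℝ≥0) < σ} := by
    have h1 : ContinuousOn (fun s : ℝ≥0 ↦ swallowingProb (2 / (κ : ℝ))
        (twoPointRatio (sleDriving κ ω) x y s)) {s | (s : WithTop ℝ≥0) < σ} :=
      (continuousOn_swallowingProb ha.1 ha.2).comp (Loewner.continuousOn_twoPointRatio hW hW0x hW0y)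
        fun s hs ↦ Ioo_subset_Ico_self (sle_twoPointRatio_mem_Ioo hx hy hs)
    exact h1.congr fun s hs ↦ sleTwoPointObservable_of_lt hs
  rw [continuous_iff_continuousAt]
  intro t
  by_cases ht : (t : WithTop ℝ≥0) < σ
  · exact hMU.continuousAt ((isOpen_setOf_coe_lt σ).mem_nhds ht)
  rw [not_lt] at ht
  have hσtop : σ ≠ ⊤ := ne_top_of_le_ne_top WithTop.coe_ne_top ht
  obtain ⟨b, hb⟩ := WithTop.ne_top_iff_exists.1 hσtop
  have hbt : b ≤ t := by rw [← hb] at ht; exact_mod_cast ht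
  set v : ℝ := if swallowingTime (sleDriving κ ω) y < swallowingTime (sleDriving κ ω) x then 1 else 0
    with hvdef
  have hMv : ∀ s : ℝ≥0, b ≤ s → sleTwoPointObservable κ x y s ω = v := fun s hs ↦
    sleTwoPointObservable_of_le (by rw [← hσdef, ← hb]; exact_mod_cast hs)
  rcases hbt.lt_or_eq with hbt | hbt
  · -- `b < t`: locally constant
    refine (continuousAt_const (y := v)).congr ?_
    filter_upwards [Ioi_mem_nhds hbt] with s hs
    exact (hMv s (le_of_lt hs)).symm
  subst hbt
  rw [continuousAt_iff_continuous_left'_right']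
  refine ⟨?_, (continuousWithinAt_const (b := v)).congr (fun s hs ↦ hMv s (le_of_lt hs))
    (hMv b le_rfl)⟩
  -- left continuity at `σ = b`
  rw [ContinuousWithinAt, hMv b le_rfl]
  have hσlt : σ < ⊤ := by rw [← hb]; exact WithTop.coe_lt_top b
  have hne : swallowingTime (sleDriving κ ω) x ≠ swallowingTime (sleDriving κ ω) y :=
    swallowingTime_ne_swallowingTime hW hW0x hW0y hσlt
  -- for `s < b`, `M s = Ψ (Z s)` and `Z s ∈ (0, 1)`
  have hlt : ∀ s : ℝ≥0, s < b → (s : WithTop ℝ≥0) < σ := fun s hs ↦ by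
    rw [← hb]; exact_mod_cast hs
  have hMeq : (fun s : ℝ≥0 ↦ swallowingProb (2 / (κ : ℝ)) (twoPointRatio (sleDriving κ ω) x y s))
      =ᶠ[𝓝[<] b] fun s ↦ sleTwoPointObservable κ x y s ω := by
    filter_upwards [self_mem_nhdsWithin] with s hs
    exact (sleTwoPointObservable_of_lt (hlt s hs)).symm
  by_cases hyx : swallowingTime (sleDriving κ ω) y < swallowingTime (sleDriving κ ω) x
  · -- `T_y = σ = b ≤ T_x`, frozen value `1`, `Z → 1`
    have hv : v = 1 := if_pos hyx
    have hTy : swallowingTime (sleDriving κ ω) y = b := by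
      rw [hb, hσdef, twoPointTime, min_eq_right hyx.le]
    have hTx : (b : WithTop ℝ≥0) ≤ swallowingTime (sleDriving κ ω) x := hb ▸ twoPointTime_le_left x y
    rw [hv]
    have hZ1 : Tendsto (fun s : ℝ≥0 ↦ twoPointRatio (sleDriving κ ω) x y s) (𝓝[<] b) (𝓝[<] 1) := by
      rw [tendsto_nhdsWithin_iff]
      constructor
      · rw [Metric.tendsto_nhdsWithin_nhds]
        intro ε hε
        obtain ⟨s₀, hs₀b, hs₀⟩ := one_sub_twoPointRatio_lt_of_near hW hW0x hW0y hTy hTx hε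
        refine ⟨(b : ℝ) - s₀, sub_pos.2 (NNReal.coe_lt_coe.2 hs₀b), fun s hs hdist ↦ ?_⟩
        have hsb : s < b := hs
        rw [NNReal.dist_eq, abs_sub_comm, abs_of_nonneg (sub_nonneg.2 (NNReal.coe_le_coe.2 hsb.le))]
          at hdist
        have hs₀s : s₀ ≤ s := NNReal.coe_le_coe.1 (by linarith)
        have hZ := sle_twoPointRatio_mem_Ioo (κ := κ) hx hy (hlt s hsb)
        rw [Real.dist_eq, abs_sub_comm, abs_of_nonneg (by linarith [hZ.2])]
        exact hs₀ s hs₀s hsb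
      · filter_upwards [self_mem_nhdsWithin] with s hs
        exact (sle_twoPointRatio_mem_Ioo (κ := κ) hx hy (hlt s hs)).2
    exact ((tendsto_swallowingProb_one ha.1 ha.2).comp hZ1).congr' hMeq
  · -- `T_x = σ = b ≤ T_y`, frozen value `0`, `Z → 0`
    have hv : v = 0 := if_neg hyx
    have hxy : swallowingTime (sleDriving κ ω) x < swallowingTime (sleDriving κ ω) y :=
      lt_of_le_of_ne (not_lt.1 hyx) hne
    have hTx : swallowingTime (sleDriving κ ω) x = b := by
      rw [hb, hσdef, twoPointTime, min_eq_left hxy.le]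
    have hTy : (b : WithTop ℝ≥0) ≤ swallowingTime (sleDriving κ ω) y := hb ▸ twoPointTime_le_right x y
    rw [hv]
    have hψ0 : Tendsto (swallowingProb (2 / (κ : ℝ))) (𝓝[Ico 0 1] 0) (𝓝 0) := by
      have := (continuousOn_swallowingProb ha.1 ha.2) 0 (by simp)
      rwa [ContinuousWithinAt, swallowingProb_zero_right ha.1 ha.2] at this
    have hZ0 : Tendsto (fun s : ℝ≥0 ↦ twoPointRatio (sleDriving κ ω) x y s) (𝓝[<] b)
        (𝓝[Ico 0 1] 0) := by
      rw [tendsto_nhdsWithin_iff]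
      constructor
      · rw [Metric.tendsto_nhdsWithin_nhds]
        intro ε hε
        obtain ⟨s₀, hs₀b, hs₀⟩ := twoPointRatio_lt_of_near hW hW0x hW0y hTx hTy hε
        refine ⟨(b : ℝ) - s₀, sub_pos.2 (NNReal.coe_lt_coe.2 hs₀b), fun s hs hdist ↦ ?_⟩
        have hsb : s < b := hs
        rw [NNReal.dist_eq, abs_sub_comm, abs_of_nonneg (sub_nonneg.2 (NNReal.coe_le_coe.2 hsb.le))]
          at hdist
        have hs₀s : s₀ ≤ s := NNReal.coe_le_coe.1 (by linarith)
        have hZ := sle_twoPointRatio_mem_Ioo (κ := κ) hx hy (hlt s hsb)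
        rw [Real.dist_eq, sub_zero, abs_of_nonneg hZ.1.le]
        exact hs₀ s hs₀s hsb
      · filter_upwards [self_mem_nhdsWithin] with s hs
        exact Ioo_subset_Ico_self (sle_twoPointRatio_mem_Ioo (κ := κ) hx hy (hlt s hs))
    exact (hψ0.comp hZ0).congr' hMeq

end Paths

end Literature.Probability.RandomPlanarGeometry
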